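import Summits.BirchSwinnertonDyer.Rank1Residual.X11a.PrintSkinnerThmCNoRam
import Summits.BirchSwinnertonDyer.Rank1Residual.GaloisImage.MultiplicativeLargeImage
import Summits.BirchSwinnertonDyer.Rank1Residual.X11b.MultiplicativeSurjectivity
import Literature.NumberTheory.EllipticCurves.Rank1Residual.Typed.X11Visibility
import Literature.NumberTheory.EllipticCurves.Rank1Residual.X9NoEntry
import Literature.NumberTheory.EllipticCurves.BSDSelmerSkinnerProofs
import HarnessLib

/-!
# Class X11a — the PRINT route's discharge interface, part 1: `ClassX11a W p ⟹` the hypotheses of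
# the cited theorems, exactly as the tree states them (cell `bsd-print-x11a`, seat ty2; D-0131 (2))

PARTITION CURRENCY (D-0054 (2) / D-0131 (2)): the leaf is the partition row
`ClassX11a W p := W.analyticRank = 0 ∧ p ≠ 2 ∧ Mult W p ∧ Irr W p ∧ ¬ Ram W p`
(`Summits/…/Rank1Residual/Partition/Rows.lean`; LADDER-BSD K2 row A9, barrier B3): analytic rank
`0`, an ODD prime `p ‖ N`, `E[p]` irreducible, and NO auxiliary prime `q ‖ N`, `q ≠ p`, with `E[p]`
ramified at `q` («no-ram»). THEOREMS ONLY: no definition, no named fact, nothing asserted; every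
published input is an explicit named-fact hypothesis already in the tree (`hmod`, `hGZK`, `hB`,
`hCT`, `hW`) or a tree theorem. The atoms of `X11a/Cells.lean` (`ClassX11a.analyticRank_eq_zero`,
`.ne_two`, `.mult`, `.irr`, `.not_ram`, `.L_one_ne_zero`, `.toX11`) and seat p1's Skinner-Thm.-C
ledger (`X11a/PrintSkinnerThmCNoRam.lean`: `ClassX11a.three_le`, `.thmC_printedHypotheses`,
`.not_thmC_hypothesis_ii`, `ThmCNoRam`, `ClassX11a.bsdp_of_thmCNoRam`) are used, not restated.

WHAT THIS FILE IS. The print route closes the leaf BY NAME: "cited theorem, typed exactly (ty1) +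
per-class hypothesis discharge (this file) ⇒ `BSDp W p`". For every theorem the prover strategies
cite, each hypothesis ON THE PAIR `(W, p)` is derived here from `ClassX11a W p` in the RAW spelling
of the Literature fact, or isolated as a named PER-PAIR BIT (a decidable datum of the certificate
record) when the class does not imply it; the conclusion shapes are glued to Miller's `BSDp W p`.

| hypothesis (tree spelling) | on `ClassX11a W p` | lemma |
|---|---|---|
| `3 ≤ p`, `p ≠ 2`, `2 < p`; `5 ≤ p` / `3 < p` | implied; ⟺ `p ≠ 3` (`CellThree` is `p = 3`) | `three_le` (p1), `two_lt`, `five_le_of_ne_three`, `three_lt_of_ne_three` |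
| `(good ∧ p ∤ a_p) ∨ mult` (Skinner 2016 Thm. C `_hred`) | implied | `goodOrd_or_mult` |
| `W.HasGoodReductionAtPrime p` (BCS 2025, BSTW 10.10 (a), JSW, CGS) | REFUTED (`p ‖ N`) | `not_good`, `not_goodOrd`, `not_rowC2` |
| `¬ W.HasCM` (BCS, EPW, BDMTV) | implied | `not_hasCM` |
| (ram) `∃ ℓ ≠ p, ℓ ‖ N, p ∤ v_ℓ(Δ_min)` (Skinner 2016 A (iii)/C (ii), S–U) | REFUTED — the defining gap | `not_ram` (Cells), `dvd_padicValInt_of_mult`, `not_rowC1`, `rowC1_iff_ram_of_atoms` |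
| `Finite W.sha`, `rank E(ℚ) = 0`, `ord_p #E(ℚ)_tors = 0` | implied (GZK `hGZK`; Mazur) | `finite_sha`, `mordellWeilRank_eq_zero`, `padicValNat_torsionOrder_eq_zero` |
| `Surj W p` (Kato–Wuthrich, Fouquet Ass. 2.9 (1), visibility, Wuthrich Prop. 21) | PER-PAIR BIT; THEOREM if `11 ≤ p` (`hB`), or `p ∤ v_p(Δ_min)`, or `W` semistable | `surj_of_eleven_le` (GaloisImage), `surj_of_not_dvd` (X11b), `surj_of_semistable`, `not_surj_shape` |
| `∀ n, W.HasSurjectiveModNGaloisRep (p^n)` | from the bit + `p ≠ 3` (Serre) | `surjective_pow` |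
| a covered row C1–C17 of the partition | none applies | `not_covered` |

BUNDLES (one tuple per cited theorem, in the fact's binder order): `thmC_printedHypotheses` (p1's
file; Skinner 2016 Thm. C: everything but `_hram`), `thmA_hypotheses_sans_ram`, `katoWuthrich_hypotheses`
(Wuthrich 2014 Thm. 3 / Cor. 19), `not_wuthrich_exceptional` (Prop. 21), `visibility_hypotheses`.
OUTPUT GLUE: `PPartRankZero W p ⇒ BSDp` (`bsdp_of_pPartRankZero'`, unfolded `bsdp_of_padicValRat`),
`X11RankZero.MissingInputAt ⇒ BSDp` (`bsdp_of_x11RankZeroMissingInputAt`), the crux halves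
`MissingLowerBoundAt` (+ the `Surj` bit, Wuthrich Prop. 21) / `+ MissingUpperBoundAt` ⇒ `BSDp`
(`bsdp_of_missingLowerBoundAt_of_surj`, `bsdp_of_halves`); Mazur's main conjecture
at the pair ⇒ `BSDp` is `X11a.bsdp_of_mazurMainConjectureAt`, Wuthrich Prop. 21 on the unit sub-cell
is `X11a.CellPub.bsdp` (Cells). CLOSING FORM: `bsdp_of_congr_of_rank_two` (visibility, pair side
discharged). Part 2 (`X11a/PrintDischargeFouquet.lean`): the Fouquet 2025 + BCS-seed road.

References: [Skinner2016PacificMC] Thm. A, C; [Wuthrich2014] Thm. 3, Cor. 19, Prop. 21;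
[BalakrishnanEtAl2019] Thm. 1.2; [Serre1972] §5.4 Prop. 21; [SilvermanATAEC1994] II.6.4, V.6.1;
[Miller2011LMS] Def. 1.1; [CremonaMazur2000] §3; `X11a/Cells.lean`, `Typed/X11Visibility.lean`.
-/

set_option autoImplicit false

noncomputable section

open scoped Classical

open WeierstrassCurve Literature.NumberTheory.EllipticCurves
  Literature.NumberTheory.EllipticCurves.ModularForms
  Literature.NumberTheory.EllipticCurves.Rank1Residual
  Literature.NumberTheory.EllipticCurves.Rank1Residual.Typed
  Literature.NumberTheory.EllipticCurves.Wuthrich2014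
  Literature.NumberTheory.EllipticCurves.BalakrishnanEtAl2019

namespace Summit.BirchSwinnertonDyer.Rank1Residual.X11a

variable {W : WeierstrassCurve ℚ} [W.IsElliptic] [W.IsGloballyMinimal] {p : ℕ} [Fact p.Prime]

/-! ### §1 Atoms in the raw vocabulary of the Literature facts -/

/- `p ≥ 3` on X11a — the binder `_hp : 3 ≤ p` of Skinner 2016 Thm. A/C — is the tree theorem
`ClassX11a.three_le` of `X11a/PrintSkinnerThmCNoRam.lean` (seat p1), used below and NOT restated;
likewise the positive discharge ledger of Thm. C, `ClassX11a.thmC_printedHypotheses hmod hGZK hX :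
3 ≤ p ∧ _hred ∧ Irr ∧ L(E,1) ≠ 0 ∧ Finite Ш`, and `ClassX11a.not_thmC_hypothesis_ii` (= `not_ram`). -/

omit [W.IsElliptic] in
/-- `2 < p` on X11a (the binder of the Eisenstein/CGS-shaped facts). [folklore] -/
theorem _root_.Summit.BirchSwinnertonDyer.Rank1Residual.ClassX11a.two_lt (hX : ClassX11a W p) :
    2 < p := by have := hX.three_le; omega

omit [W.IsElliptic] in
/-- On X11a the prime is `3` or `≥ 5` (the sub-cell split `CellThree` / `CellPub ∪ Leaf` of
`X11a/Cells.lean`). [folklore] -/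
theorem _root_.Summit.BirchSwinnertonDyer.Rank1Residual.ClassX11a.eq_three_or_five_le
    (hX : ClassX11a W p) : p = 3 ∨ 5 ≤ p := by
  have hpP : p.Prime := Fact.out
  have h3 := hX.three_le
  have h4 : p ≠ 4 := fun h4 => by rw [h4] at hpP; exact absurd hpP (by decide)
  by_cases h : p = 3
  exacts [Or.inl h, Or.inr (by omega)]

omit [W.IsElliptic] in
/-- `p ≥ 5` on X11a away from `p = 3` (the binder `5 ≤ p` of the Fouquet 2025 facts, of Wuthrich
2014 Cor. 19 / Serre's `p`-adic surjectivity, of the visibility consumer). [folklore] -/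
theorem _root_.Summit.BirchSwinnertonDyer.Rank1Residual.ClassX11a.five_le_of_ne_three
    (hX : ClassX11a W p) (h3 : p ≠ 3) : 5 ≤ p :=
  (hX.eq_three_or_five_le).resolve_left h3

omit [W.IsElliptic] in
/-- `3 < p` on X11a away from `p = 3` (the binder `3 < p` of the BCS-shaped facts). [folklore] -/
theorem _root_.Summit.BirchSwinnertonDyer.Rank1Residual.ClassX11a.three_lt_of_ne_three
    (hX : ClassX11a W p) (h3 : p ≠ 3) : 3 < p := by have := hX.five_le_of_ne_three h3; omega

omit [W.IsElliptic] in
/-- The reduction binder of Skinner 2016 Thm. C in the tree's literal shape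
(`_hred : (good ∧ p ∤ a_p) ∨ multiplicative`), discharged on the multiplicative branch.
[cite: Skinner2016PacificMC, Thm. C (§1) ("good ordinary or multiplicative reduction")] -/
theorem _root_.Summit.BirchSwinnertonDyer.Rank1Residual.ClassX11a.goodOrd_or_mult (hX : ClassX11a W p) :
    (W.HasGoodReductionAtPrime p ∧ ¬ (p : ℤ) ∣ W.frobeniusTrace p) ∨
      W.HasMultiplicativeReductionAtPrime p :=
  Or.inr hX.mult

omit [W.IsElliptic] in
/-- **Wall**: `p` is NOT a prime of good reduction on X11a (`p ‖ N`), so every GOOD-reduction theorem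
(BCS 2025 Cor. 1.3.1, BSTW Thm. 10.10 (a), JSW 2017, CGS 2025) is inapplicable AT `p`.
[cite: SilvermanAEC2009, VII.5.1 (good/multiplicative/additive trichotomy)] -/
theorem _root_.Summit.BirchSwinnertonDyer.Rank1Residual.ClassX11a.not_good (hX : ClassX11a W p) :
    ¬ W.HasGoodReductionAtPrime p :=
  WeierstrassCurve.HasMultiplicativeReduction.not_hasGoodReduction (R := ℤ_[p]) hX.mult

omit [W.IsElliptic] in
/-- Hence not good ordinary at `p` (the binder `GoodOrd W p` of RowC2/RowC7/RowC16 fails). [folklore] -/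
theorem _root_.Summit.BirchSwinnertonDyer.Rank1Residual.ClassX11a.not_goodOrd (hX : ClassX11a W p) :
    ¬ GoodOrd W p := fun h => hX.not_good h.1

omit [W.IsElliptic] in
/-- … and not good supersingular at `p`. [folklore] -/
theorem _root_.Summit.BirchSwinnertonDyer.Rank1Residual.ClassX11a.not_goodSS (hX : ClassX11a W p) :
    ¬ GoodSS W p := fun h => hX.not_good h.1

omit [W.IsElliptic] in
/-- … and not additive at `p` (Wuthrich Prop. 21's exceptional set: `p` additive is excluded). [folklore] -/
theorem _root_.Summit.BirchSwinnertonDyer.Rank1Residual.ClassX11a.not_addv (hX : ClassX11a W p) :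
    ¬ Addv W p := fun h => h.2 hX.mult

omit [W.IsElliptic] in
/-- `E[p]` is not reducible on X11a (the Eisenstein rows C6/C7 and classes X1–X3 are disjoint from
the leaf). [folklore] -/
theorem _root_.Summit.BirchSwinnertonDyer.Rank1Residual.ClassX11a.not_red (hX : ClassX11a W p) :
    ¬ Red W p := fun h => h hX.irr

/-- **`E` has no CM on X11a**: a CM curve has potentially good reduction everywhere, hence no
multiplicative prime (tree theorem `not_hasCM_of_hasMultiplicativeReductionAtPrime'`, Silverman
*ATAEC* II.6.4). Discharges the binder `¬ W.HasCM` of the BCS / EPW / BDMTV-shaped facts.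
[cite: SilvermanATAEC1994, II.6.4] -/
theorem _root_.Summit.BirchSwinnertonDyer.Rank1Residual.ClassX11a.not_hasCM
    (hX : ClassX11a W p) : ¬ W.HasCM :=
  not_hasCM_of_hasMultiplicativeReductionAtPrime' W hX.mult

omit [W.IsElliptic] in
/-- `ord_{s=1} L(E,s) ≤ 1` on X11a (the rank binder of the class targets and of GZK). [folklore] -/
theorem _root_.Summit.BirchSwinnertonDyer.Rank1Residual.ClassX11a.analyticRank_le_one
    (hX : ClassX11a W p) : W.analyticRank ≤ 1 := by
  rw [hX.analyticRank_eq_zero]; exact zero_le_one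

/-- **`Ш(E/ℚ)` is finite on X11a** (Gross–Zagier–Kolyvagin in analytic rank `0`, named fact `hGZK` =
bsd.S17): the binder `_hfin : Finite W.sha` of Skinner 2016 Thm. C / Fouquet 2025 / Wuthrich Prop. 21.
[cite: Kolyvagin1990, Thm. A (finiteness of Ш for r_an = 0)] -/
theorem _root_.Summit.BirchSwinnertonDyer.Rank1Residual.ClassX11a.finite_sha
    (hGZK : rank_eq_analyticRank_of_analyticRank_le_one) (hX : ClassX11a W p) : Finite W.sha :=
  (hGZK W hX.analyticRank_le_one).2

/-- `rank E(ℚ) = 0` on X11a (GZK `hGZK`). [cite: Kolyvagin1990, Thm. A] -/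
theorem _root_.Summit.BirchSwinnertonDyer.Rank1Residual.ClassX11a.mordellWeilRank_eq_zero
    (hGZK : rank_eq_analyticRank_of_analyticRank_le_one) (hX : ClassX11a W p) :
    W.mordellWeilRank = 0 := by
  rw [(hGZK W hX.analyticRank_le_one).1, hX.analyticRank_eq_zero]

/-- The torsion term of the print shape is a `p`-adic unit on X11a: `ord_p #E(ℚ)_tors = 0`
(`E[p]` irreducible ⇒ no rational `p`-torsion; tree theorem, Mazur). [cite: Mazur1977, III.§5] -/
theorem _root_.Summit.BirchSwinnertonDyer.Rank1Residual.ClassX11a.padicValNat_torsionOrder_eq_zero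
    (hX : ClassX11a W p) : padicValNat p W.torsionOrder = 0 :=
  padicValNat_torsionOrder_eq_zero_of_irreducible W p hX.irr

omit [W.IsElliptic] in
/-- **The positive content of «no-ram»**: at EVERY multiplicative prime `q ≠ p` of an X11a pair,
`p ∣ v_q(Δ_min)` — by Tate's parametrisation, `E[p]` is UNRAMIFIED at `q` (the premise of Fouquet's
Ass. 3.4 case (5); the obstruction to Skinner–Urban's / Skinner's hypothesis (ram); the condition
under which Ribet's theorem lowers the level at `q`). [cite: SkinnerUrban2014, Thm. 2 (p. 3), second bullet]
[cite: SilvermanATAEC1994, V.6 Prop. 6.1 (p. 410)] -/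
theorem _root_.Summit.BirchSwinnertonDyer.Rank1Residual.ClassX11a.dvd_padicValInt_of_mult
    (hX : ClassX11a W p) {q : ℕ} [hq : Fact q.Prime] (hqp : q ≠ p)
    (hmult : W.HasMultiplicativeReductionAtPrime q) :
    p ∣ padicValInt q W.minimalDiscriminantInt := by
  by_contra h
  exact hX.not_ram ⟨q, hq, hqp, hmult, h⟩

/-! ### §2 The covered rows of the partition do not apply (walls as theorems) -/

omit [W.IsElliptic] in
/-- **Wall (Skinner 2016 Thm. C)**: row C1 — the full hypothesis set of Thm. C as the tree states it
(`RowC1 = r = 0 ∧ 3 ≤ p ∧ (GoodOrd ∨ Mult) ∧ Irr ∧ Ram`) — FAILS on X11a, and fails EXACTLY at (ram):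
the other four conjuncts hold (`three_le`, `goodOrd_or_mult`, `irr`, `analyticRank_eq_zero`).
[cite: Skinner2016PacificMC, Thm. C (§1), hypothesis (ii)] -/
theorem _root_.Summit.BirchSwinnertonDyer.Rank1Residual.ClassX11a.not_rowC1 (hX : ClassX11a W p) :
    ¬ RowC1 W p := fun h => hX.not_ram h.2.2.2.2

omit [W.IsElliptic] in
/-- Row C1 holds at an X11a-shaped pair iff (ram) does: on `r = 0 ∧ p ≥ 3 ∧ Mult ∧ Irr` the ONLY
missing hypothesis of Skinner 2016 Thm. C is (ram). [cite: Skinner2016PacificMC, Thm. C (§1), hypothesis (ii)] -/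
theorem rowC1_iff_ram_of_atoms (hr : W.analyticRank = 0) (hp : 3 ≤ p) (hmult : Mult W p)
    (hirr : Irr W p) : RowC1 W p ↔ Ram W p :=
  ⟨fun h => h.2.2.2.2, fun h => ⟨hr, hp, Or.inr hmult, hirr, h⟩⟩

omit [W.IsElliptic] in
/-- **Wall (Burungale–Castella–Skinner 2025 Cor. 1.3.1 as typed)**: row C2 needs good ORDINARY
reduction at `p`; on X11a `p ‖ N`. [cite: BurungaleCastellaSkinner2025, Cor. 1.3.1 (p. 4) ("p ∤ N a prime of good ordinary reduction")] -/
theorem _root_.Summit.BirchSwinnertonDyer.Rank1Residual.ClassX11a.not_rowC2 (hX : ClassX11a W p) :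
    ¬ RowC2 W p := fun h => hX.not_goodOrd h.2.2.1

/-- **No covered row of the partition applies on X11a** (C1: (ram); C2, C7, C16: good ordinary; C3:
rank one; C6: reducible; C8, C10, C17: CM). Direct on the `Prop`s; agrees with the reflected table
`Partition/CornersDecideSharp.not_covered_of_corners`. [folklore] -/
theorem _root_.Summit.BirchSwinnertonDyer.Rank1Residual.ClassX11a.not_covered (hX : ClassX11a W p) :
    ¬ Covered W p := by
  rintro (h1 | h2 | h3 | h6 | h7 | h8 | h10 | h16 | h17)
  · exact hX.not_rowC1 h1
  · exact hX.not_rowC2 h2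
  · have := h3.1; have := hX.analyticRank_eq_zero; omega
  · exact h6.2.1 hX.irr
  · exact hX.not_goodOrd h7.2.2.2.1
  · exact hX.not_hasCM h8.1
  · exact hX.not_hasCM h10.1
  · exact hX.not_goodOrd h16.2.1
  · exact hX.not_hasCM h17.1

/-! ### §3 The image of `ρ̄_{E,p}`: where the surjectivity binder is a theorem, and the shape of
the non-surjective sub-leaf -/

/-- **Semistable curves**: on X11a with `W` semistable, `ρ̄_{E,p}` is onto (irreducible ⇒ surjective
for semistable `E/ℚ`, Serre 1972 §5.4 Prop. 21 i) — tree theorem `surj_of_irr_of_semistable`).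
[cite: Serre1972, §5.4 Prop. 21 i)] -/
theorem _root_.Summit.BirchSwinnertonDyer.Rank1Residual.ClassX11a.surj_of_semistable
    (hX : ClassX11a W p) (hsst : Semistable W) : Surj W p :=
  surj_of_irr_of_semistable W p hX.irr hsst

/- **`p ≥ 11`**: on X11a `ρ̄_{E,p}` is onto, granted Bilu–Parent–Rebolledo / BDMTV 2019 Thm. 1.2
(named fact `hB`) — this is the tree theorem `ClassX11a.surj_of_eleven_le W p hB hX h11`
(`GaloisImage/MultiplicativeLargeImage.lean`), used below and NOT restated. -/

/-- **The non-surjective sub-leaf of X11a has the shape `p ∈ {5, 7}`, `p ∣ v_p(Δ_min)` (peu ramifié),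
`W` non-semistable** (at `p ≥ 5`; BDMTV `hB` for the first clause; Serre/Tate — tree theorems — for
the other two). Boundary statement for the referee: every other X11a pair at `p ≥ 5` has `Surj W p`
as a THEOREM. [cite: BalakrishnanEtAl2019, §1 Thm. 1.2] [cite: SilvermanATAEC1994, V.6 Prop. 6.1 (p. 410)]
[cite: Serre1972, §5.4 Prop. 21 i)] -/
theorem _root_.Summit.BirchSwinnertonDyer.Rank1Residual.ClassX11a.not_surj_shape
    (hB : thm12_not_le_normalizer_splitCartan) (hX : ClassX11a W p) (h5 : 5 ≤ p) (hns : ¬ Surj W p) :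
    (p = 5 ∨ p = 7) ∧ p ∣ padicValInt p W.minimalDiscriminantInt ∧ ¬ Semistable W := by
  refine ⟨GaloisImage.eq_five_or_eq_seven_of_mult_of_irr_of_not_surj W p hB h5 hX.mult hX.irr hns,
    by_contra fun h => hns (ClassX11a.surj_of_not_dvd W p hX h), fun h => hns (hX.surj_of_semistable h)⟩

/-- **`ρ_{E,p^n}` onto for every `n`** from the mod-`p` bit at `p ≥ 5` (Serre 1968 IV §3.4, tree
theorem `serre_hasSurjectiveModNGaloisRep_pow_holds`): the image binder of
`Wuthrich2014.kato_charIdeal_dvd_multiplicative_of_surjective` and of the BCS-seed partner.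
[cite: SerreAbelianLadic1968, Ch. IV §3.4] [cite: Wuthrich2014, Cor. 19 proof (p. 399)] -/
theorem _root_.Summit.BirchSwinnertonDyer.Rank1Residual.ClassX11a.surjective_pow
    (hX : ClassX11a W p) (h3 : p ≠ 3) (hsurj : Surj W p) :
    ∀ n : ℕ, W.HasSurjectiveModNGaloisRep (p ^ n : ℕ) :=
  serre_hasSurjectiveModNGaloisRep_pow_holds W p (hX.five_le_of_ne_three h3) hsurj

/-! ### §4 Hypothesis bundles, theorem by theorem -/

omit [W.IsElliptic] in
/-- **Skinner 2016 Thm. A — hypotheses (i) `p ≥ 3`, multiplicative, (ii) irreducible**, in the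
spelling of `Skinner2016.thmA_charIdeal_multiplicative`; (iii) = (ram) is refuted (`not_ram`); the
conclusion shape (Mazur's main conjecture at the pair, `X2.MazurMainConjectureAt W p`) gives `BSDp`
by `X11a.bsdp_of_mazurMainConjectureAt` (Cells). [cite: Skinner2016PacificMC, Thm. A (§1)] -/
theorem _root_.Summit.BirchSwinnertonDyer.Rank1Residual.ClassX11a.thmA_hypotheses_sans_ram
    (hX : ClassX11a W p) :
    3 ≤ p ∧ W.HasMultiplicativeReductionAtPrime p ∧ W.HasIrreducibleModPGaloisRep p :=
  ⟨hX.three_le, hX.mult, hX.irr⟩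

/-- **Kato's divisibility at `p ‖ N` for surjective image (Wuthrich 2014 Thm. 3 / Cor. 19, fact
`Wuthrich2014.kato_charIdeal_dvd_multiplicative_of_surjective`) — the pair-side binders `p ≠ 2`,
multiplicative, `ρ_{E,p^n}` onto for all `n`**, from the class, `p ≠ 3` and the mod-`p` bit
(strategy p3; the converse chain `X11a/MainConjecture.lean` consumes exactly these).
[cite: Wuthrich2014, Thm. 3 and Cor. 19 (pp. 382, 399)] -/
theorem _root_.Summit.BirchSwinnertonDyer.Rank1Residual.ClassX11a.katoWuthrich_hypotheses
    (hX : ClassX11a W p) (h3 : p ≠ 3) (hsurj : Surj W p) :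
    p ≠ 2 ∧ W.HasMultiplicativeReductionAtPrime p ∧
      ∀ n : ℕ, W.HasSurjectiveModNGaloisRep (p ^ n : ℕ) :=
  ⟨hX.ne_two, hX.mult, hX.surjective_pow h3 hsurj⟩

omit [W.IsElliptic] in
/-- **Wuthrich 2014 Prop. 21 (fact `sha_dvd_analyticSha`) — the pair is OUTSIDE its exceptional
set** `p = 2 ∨ additive at p ∨ (¬surj ∧ irr)` as soon as the mod-`p` bit holds: on X11a `p` is odd
and multiplicative (not additive over `ℤ_p`). The consumer on the unit sub-cell is `X11a.CellPub.bsdp`.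
[cite: Wuthrich2014, Prop. 21 (p. 400)] -/
theorem _root_.Summit.BirchSwinnertonDyer.Rank1Residual.ClassX11a.not_wuthrich_exceptional
    (hX : ClassX11a W p) (hsurj : Surj W p) :
    ¬ (p = 2 ∨ ((W.baseChange ℚ_[p]).minimal ℤ_[p]).HasAdditiveReduction ℤ_[p] ∨
      (¬ W.HasSurjectiveModNGaloisRep p ∧ W.HasIrreducibleModPGaloisRep p)) := by
  rintro (h2 | hadd | ⟨hns, -⟩)
  · exact hX.ne_two h2
  · exact WeierstrassCurve.HasMultiplicativeReduction.not_hasAdditiveReduction (R := ℤ_[p]) hX.mult hadd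
  · exact hns hsurj

omit [W.IsElliptic] in
/-- **Visibility (Cremona–Mazur 2000 §3 / Agashe–Stein) — the pair-side binders** of
`X11RankZero.bsdp_of_congr_of_rank_two` (`p ≠ 2`, `r = 0`, `ClassX11 W p`), from the class; the
image bit `Surj W p`, the bound `ord_p #Ш_an ≤ 2` and the rank-two partner data are per pair
(strategy p4). [cite: CremonaMazur2000, §3 (p. 21, conditions (1)–(3) and the Proposition)] -/
theorem _root_.Summit.BirchSwinnertonDyer.Rank1Residual.ClassX11a.visibility_hypotheses
    (hX : ClassX11a W p) : p ≠ 2 ∧ W.analyticRank = 0 ∧ ClassX11 W p :=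
  ⟨hX.ne_two, hX.analyticRank_eq_zero, hX.toX11⟩

/-! ### §5 Output glue: conclusion shapes ⇒ `BSDp W p` on the class -/

/-- **The rank-`0` print shape closes the pair**: `PPartRankZero W p` — the displayed conclusion of
Skinner 2016 Thm. C, of Fouquet 2025 Thm. 1.7 (2) (via §2.2), of the EPW transfer — gives Miller's
`BSDp W p` on X11a (GZK `hGZK`, modularity `hmod`; tree theorem `bsdp_of_pPartRankZero`).
[cite: Miller2011LMS, §1 and Def. 1.1 (arXiv:1010.2431 p. 3)] [cite: Skinner2016PacificMC, Thm. C (display)] -/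
theorem _root_.Summit.BirchSwinnertonDyer.Rank1Residual.ClassX11a.bsdp_of_pPartRankZero'
    (hmod : hasEntireLFunction_rat) (hGZK : rank_eq_analyticRank_of_analyticRank_le_one)
    (hX : ClassX11a W p) (h : PPartRankZero W p) : BSDp W p :=
  bsdp_of_pPartRankZero W p hmod hGZK hX.analyticRank_eq_zero h

/-- The same with the print shape unfolded (the literal conclusion `∃ q, L(E,1)/Ω = q ∧ ord_p q = …`
of the Skinner / Fouquet facts). [cite: Miller2011LMS, §1 and Def. 1.1] -/
theorem _root_.Summit.BirchSwinnertonDyer.Rank1Residual.ClassX11a.bsdp_of_padicValRat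
    (hmod : hasEntireLFunction_rat) (hGZK : rank_eq_analyticRank_of_analyticRank_le_one)
    (hX : ClassX11a W p)
    (h : ∃ q : ℚ, W.entireLFunction 1 / (W.realPeriodRat : ℂ) = (q : ℂ) ∧
      padicValRat p q = (padicValNat p W.shaOrder : ℤ) + padicValNat p W.tamagawaProduct -
        2 * padicValNat p W.torsionOrder) : BSDp W p :=
  hX.bsdp_of_pPartRankZero' hmod hGZK h

/-- **The typed residue closes the pair**: `X11RankZero.MissingInputAt W p` (the lower bound
`ord_p #Ш_an ≤ ord_p #Ш` if `ρ̄` is onto, the whole `p`-part otherwise; `Typed/X11.lean`) gives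
`BSDp W p` on X11a (Wuthrich Prop. 21 `hW`, GZK, modularity). [cite: Wuthrich2014, Prop. 21 (p. 400)]
[cite: Miller2011LMS, §1 and Def. 1.1] -/
theorem _root_.Summit.BirchSwinnertonDyer.Rank1Residual.ClassX11a.bsdp_of_x11RankZeroMissingInputAt
    (hW : sha_dvd_analyticSha) (hGZK : rank_eq_analyticRank_of_analyticRank_le_one)
    (hmod : hasEntireLFunction_rat) (hX : ClassX11a W p) (hmiss : X11RankZero.MissingInputAt W p) :
    BSDp W p :=
  X11RankZero.bsdp_of_missingInputAt hW hGZK hmod W p hX.ne_two hX.analyticRank_eq_zero hX.toX11 hmiss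

/-- **The LOWER half closes a surjective pair**: on X11a with the mod-`p` bit, the typed lower
bound `MissingLowerBoundAt W p` (`ord_p #Ш_an ≤ ord_p #Ш` — the shape of the route crux
`X11aLowerHalf`) gives `BSDp W p`, the upper bound being Wuthrich 2014 Prop. 21 (`hW`; `p` odd,
non-additive, `ρ̄` onto). Tree glue `bsdp_of_missingLowerBoundAt_of_wuthrich` with the pair side
discharged. [cite: Wuthrich2014, Prop. 21 (p. 400)] [cite: Miller2011LMS, §1 and Def. 1.1] -/
theorem _root_.Summit.BirchSwinnertonDyer.Rank1Residual.ClassX11a.bsdp_of_missingLowerBoundAt_of_surj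
    (hW : sha_dvd_analyticSha) (hGZK : rank_eq_analyticRank_of_analyticRank_le_one)
    (hmod : hasEntireLFunction_rat) (hX : ClassX11a W p) (hsurj : Surj W p)
    (hlow : MissingLowerBoundAt W p) : BSDp W p :=
  bsdp_of_missingLowerBoundAt_of_wuthrich W p hW hGZK hmod hX.ne_two hX.analyticRank_eq_zero
    (WeierstrassCurve.HasMultiplicativeReduction.not_hasAdditiveReduction (R := ℤ_[p]) hX.mult)
    (Or.inr hsurj) hlow

/-- **Both halves close any pair** (no image hypothesis): `MissingLowerBoundAt W p` and
`MissingUpperBoundAt W p` (the shapes of the two cruxes on the non-surjective sub-leaf) give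
`BSDp W p` on X11a (GZK only). [cite: Miller2011LMS, §1 and Def. 1.1] -/
theorem _root_.Summit.BirchSwinnertonDyer.Rank1Residual.ClassX11a.bsdp_of_halves
    (hGZK : rank_eq_analyticRank_of_analyticRank_le_one) (hX : ClassX11a W p)
    (hlow : MissingLowerBoundAt W p) (hup : MissingUpperBoundAt W p) : BSDp W p :=
  bsdp_of_missingPPartAt W p hGZK hX.analyticRank_le_one (missingPPartAt_of_lower_of_upper W p hlow hup)

/-! ### §6 Closing form BY NAME with the pair side discharged: visibility (partner data per pair) -/

open IsDedekindDomain NumberField in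
/-- **Visibility ⇒ `BSD(E,p)` on X11a** (Cremona–Mazur 2000 §3 / Agashe–Stein 2002 Thm. 3.1 as the
KERNEL theorem `exists_sha_ne_zero_of_congr_of_rank`, + Wuthrich Prop. 21 `hW` + Cassels–Tate `hCT`
+ GZK + modularity; tree consumer `X11RankZero.bsdp_of_congr_of_rank_two`) with the pair side
discharged from the class: remaining per pair are the mod-`p` image bit, `ord_p #Ш_an ≤ 2`, and the
rank-two partner `W'` with `θ : W'[p] ≃ W[p]`, the set `S` and the local triviality of `W'(ℚ_v)[p]`.
[cite: CremonaMazur2000, §3 (p. 21)] [cite: Wuthrich2014, Prop. 21 (p. 400)] -/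
theorem bsdp_of_congr_of_rank_two (hCT : exists_casselsTate_pairing (K := ℚ))
    (hW : sha_dvd_analyticSha) (hGZK : rank_eq_analyticRank_of_analyticRank_le_one)
    (hmod : hasEntireLFunction_rat) (hX : ClassX11a W p) (hsurj : Surj W p)
    {q : ℚ} (hq : shaAn W = (q : ℂ)) (hv : padicValRat p q ≤ 2)
    (W' : WeierstrassCurve ℚ) [W'.IsElliptic]
    (θ : geomTorsion W' (p : ℤ) ≃+ geomTorsion W (p : ℤ))
    (hθ : ∀ (σ : Field.absoluteGaloisGroup ℚ) (P : geomTorsion W' (p : ℤ)), θ (σ • P) = σ • θ P)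
    (hrank : 2 ≤ W'.mordellWeilRank) (S : Finset (HeightOneSpectrum (𝓞 ℚ)))
    (hS : ∀ v : HeightOneSpectrum (𝓞 ℚ), v ∉ S →
      W.HasGoodReductionAt v ∧ W'.HasGoodReductionAt v ∧ (p : 𝓞 ℚ) ∉ v.asIdeal)
    (hloc : ∀ v ∈ S, Nat.card (nsmulAddMonoidHom p :
      (W'.baseChange (v.adicCompletion ℚ)).toAffine.Point →+ _).ker = 1) :
    BSDp W p :=
  X11RankZero.bsdp_of_congr_of_rank_two W p hCT hW hGZK hmod hX.ne_two hX.analyticRank_eq_zero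
    hX.toX11 hsurj hq hv W' θ hθ hrank S hS hloc

end Summit.BirchSwinnertonDyer.Rank1Residual.X11a

end
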